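import Summits.Ventures.GridStability.Bench.NE39SPSlabCRoa
import Summits.Ventures.GridStability.Lyapunov.NE39SPSlabCPsd

/-!
# GridStability/Bench/NE39SPSlabCMain — «G2.b-NE39SP-SLAB-CLQ» #53: the assembled sentence (model-2's `ne39_slab_roa_of` with
# sos-4's two kernel-decided PosSemidef facts)

ASSEMBLY (model-2 g6, 2026-08-27; lead g5 RULINGS BATCH 3 (2) «#53 KERNEL ARCHITECTURE OF RECORD»): `cert := certOf peS_posSemidef
aqS_posSemidef` and `ne39_slab_roa := ne39_slab_roa_of peS_posSemidef aqS_posSemidef` — sos-4's two kernel-decided PosSemidef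
interface facts (module `Lyapunov/NE39SPSlabCPsd`: 64 + 41 integer clique Gram blocks, clique-sum identity) discharge the two
hypotheses of model-2's `Bench/NE39SPSlabCRoa`. Object of record:
sos-4 cert 3f9f274c5104abf6 / hand-over 5a053876f8a67723 = p514683 (lead RULING #53 OBJECT 08:38:22Z). THREE COLUMNS and the
MODELLED / VALIDATED wording: see `Bench/NE39SPSlabCRoa`. Nothing here says the New England system or any grid is stable.
-/

noncomputable section

open Set Filter Topology Real Matrix
open Literature.MathematicalPhysics.PowerSystems
open Literature.MathematicalPhysics.PowerSystems.LyapunovFunctionFamily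
open Literature.Computation.Certificates
open Summit.Ventures.GridStability.Models
open Summit.Ventures.GridStability.Models.StructurePreserving
open Summit.Ventures.GridStability.Models.NE39SP
open Summit.Ventures.GridStability.Lyapunov.NE39SPSlabC

namespace Summit.Ventures.GridStability.Bench.NE39SPSlabC

/-- **THE NE39SP SLAB CERTIFICATE** (clique-structured `P`, sos-4's PSD facts discharged). -/
def cert : SlabCertificate (NE39SP.relLurie D) := certOf Summit.Ventures.GridStability.Lyapunov.NE39SPSlabC.peS_posSemidef Summit.Ventures.GridStability.Lyapunov.NE39SPSlabC.aqS_posSemidef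

/-- **«G2.b-NE39SP-SLAB-CLQ» — the certified region sentence, unconditional** (see `ne39_slab_roa_of` for the wording;
ε-level `c = 4506911/1342177280000`, window `|σ_e − σ*_e| ≤ 97/200`, slab class `u = 1/4`). -/
theorem ne39_slab_roa {y : (Fin 49 → ℝ) × (Fin 49 → ℝ)}
    (hy : ∀ e, |(y.1 (srcV e) - y.1 (tgtV e)) - (δ₀ (srcV e) - δ₀ (tgtV e))| ≤ (97 : ℝ) / 200)
    (hyc : cert.V (relState ref gnode δ₀ y) ≤ (4506911 : ℝ) / 1342177280000) :
    (∃ X : ℝ → (Fin 49 → ℝ) × (Fin 49 → ℝ), X 0 = y ∧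
        ∀ T : ℝ, ∀ t ∈ Icc 0 T, HasDerivWithinAt X ((NE39SP.params D).phaseField (X t)) (Icc 0 T) t) ∧
      ∀ X : ℝ → (Fin 49 → ℝ) × (Fin 49 → ℝ), X 0 = y →
        (∀ T : ℝ, ∀ t ∈ Icc 0 T, HasDerivWithinAt X ((NE39SP.params D).phaseField (X t)) (Icc 0 T) t) →
        (∀ t, 0 ≤ t →
            (∀ e, |((X t).1 (srcV e) - (X t).1 (tgtV e)) - (δ₀ (srcV e) - δ₀ (tgtV e))|
              < 2 * Real.arctan ((1 / 4 : ℚ) : ℝ)) ∧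
            cert.V (relState ref gnode δ₀ (X t)) ≤ (4506911 : ℝ) / 1342177280000) ∧
          (∀ v w, Tendsto (fun t => (X t).1 v - (X t).1 w) atTop (𝓝 (δ₀ v - δ₀ w))) ∧
          ∀ v ∈ genS, Tendsto (fun t => (X t).2 v) atTop (𝓝 0) :=
  ne39_slab_roa_of Summit.Ventures.GridStability.Lyapunov.NE39SPSlabC.peS_posSemidef Summit.Ventures.GridStability.Lyapunov.NE39SPSlabC.aqS_posSemidef hy hyc

end Summit.Ventures.GridStability.Bench.NE39SPSlabC

end
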